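import Summits.BirchSwinnertonDyer.BirchSwinnertonDyer.Theses.KatoDescentPotSupersingular
import Literature.NumberTheory.EllipticCurves.NonEisensteinPrimeOfSurjective
import HarnessLib

/-!
# Route `KatoDescentPotSupersingular` (rung K9, cell `bsd-potss`): the load-bearing support
# `WildRankZeroAssembly` — PROVED (item stmt-BirchSwinnertonDyer-19199)

The rank-`0` ASSEMBLY on the COVERED wild rows: granted the lower-half crux `WildLowerHalfRankZero`
(L₀), Kato's member bound `ReducibleKatoMember` (M) and the five published inputs `PublishedInputsO6`
(Kato 2004 Thm. 14.5 (3) under (12.5.2), Gross–Zagier–Kolyvagin, modularity, Cassels, Cassels–Tate),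
every O6 pair `(W, 3)` of analytic rank `0` on a covered row has `ord₃ #Ш = ord₃ #Ш_an`
(`Typed.MissingPPartAt W 3`):
* branch A (3-adic tower surjective, `3 ∤ Tam`, a modular parametrisation with `3 ∤ c_D`): tower
  surjectivity at level `3¹` gives `E[3]` irreducible (`hasIrreducibleModPGaloisRep_of_hasSurjectiveModNGaloisRep`),
  so the pair is in `ClassX4`, and the tree's `ClassO6.missingPPartAt_iff_lower_of_kato` (Kato's upper
  half) reduces the missing `3`-part to the lower half L₀;
* branch B (`E[3]` reducible, no `ℤ/9` in the class, `ord₃ #Ш_an` even): the pair is in `ClassX3`, the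
  tree's `O6.X3WildRankZero.missingUpperBoundAt_of_katoMember` (M + Cassels + Cassels–Tate parity) gives
  the upper half, and `missingPPartAt_of_lower_of_upper` joins it with L₀.
Pure bookkeeping over tree theorems; nothing about L₀ or M is asserted (they are hypotheses of the
support, i.e. the route's cruxes). Seat `bsd-potss-kmc` generation 4.
-/

set_option autoImplicit false

noncomputable section

open scoped Classical

namespace Summit.BirchSwinnertonDyer.BirchSwinnertonDyer.Theorems

open WeierstrassCurve Literature.NumberTheory.EllipticCurves
  Literature.NumberTheory.EllipticCurves.Rank1Residual
  Literature.NumberTheory.EllipticCurves.Rank1Residual.Typed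
  Summit.BirchSwinnertonDyer.Rank1Residual.Additive
  Summit.BirchSwinnertonDyer.Rank1Residual
  Summit.BirchSwinnertonDyer.BirchSwinnertonDyer.Theses.KatoDescentPotSupersingular

/-- **The K9 support `WildRankZeroAssembly`, proved** (route `KatoDescentPotSupersingular`, item
stmt-BirchSwinnertonDyer-19199): on the covered wild rank-`0` rows, L₀ + Kato's upper half (branch A,
`ClassO6.missingPPartAt_iff_lower_of_kato`) resp. L₀ + the member bound with Cassels–Tate parity
(branch B, `O6.X3WildRankZero.missingUpperBoundAt_of_katoMember`) give `MissingPPartAt W 3`.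
[cite: Kato2004Asterisque, Thm. 14.5 (3) (p. 236)] [cite: Miller2011LMS, §1 and Def. 1.1] -/
theorem wildRankZeroAssembly_proof : WildRankZeroAssembly := by
  intro hL hM hP W _ _ _ hr hO hcov
  obtain ⟨hKato, hGZK, hmod, hCassels, hCT⟩ := hP
  have hlow : MissingLowerBoundAt W 3 := hL W hr hO
  rcases hcov with ⟨hsurj, htam, N, hN, D, hc⟩ | ⟨hred, hsmall, heven⟩
  · -- branch A: covered by Kato 14.5 (3) under (12.5.2) — the missing input IS the lower half
    haveI := hN
    have hirr : W.HasIrreducibleModPGaloisRep 3 := by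
      have h1 := hsurj 1
      simp only [pow_one] at h1
      exact hasIrreducibleModPGaloisRep_of_hasSurjectiveModNGaloisRep W 3 (by exact_mod_cast h1)
    have hX : ClassX4 W 3 := ⟨hO.1, hO.2.1, hirr⟩
    exact (ClassO6.missingPPartAt_iff_lower_of_kato W 3 hKato hGZK hmod hr hO hX hsurj htam D hc).mpr hlow
  · -- branch B: reducible rows — Kato's member bound + Cassels–Tate parity give the upper half
    have hX : ClassX3 W 3 := ⟨hred, hO.2.1⟩
    exact missingPPartAt_of_lower_of_upper W 3 hlow
      (O6.X3WildRankZero.missingUpperBoundAt_of_katoMember hM hCassels hCT hGZK hmod W hX hO.2.2 hr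
        hsmall heven)

end Summit.BirchSwinnertonDyer.BirchSwinnertonDyer.Theorems

end
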